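import Literature.NumberTheory.GaloisRepresentations.ArtinConductorIntegrality
import Literature.NumberTheory.GaloisRepresentations.HerbrandTheorem
import Literature.RepresentationTheory.FiniteGroups.BrauerInduction
import HarnessLib

/-!
# The Artin representation: Serre's function `i_G`, the numerator form of `f(χ)`, and the
arithmetic inputs of Artin's integrality theorem (trunk GalRep, item C10, third layer)

Companion to `ArtinConductorIntegrality.lean`, whose named fact
`Literature.NumberTheory.GaloisRepresentations.exists_natCast_eq_artinExponent` (**Artin's theorem** `f(τ) ∈ ℕ` for a representation `τ`
of the inertia group `G_0 = I(𝔓_E)` of a finite normal extension `E/K` of a number field over any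
field of characteristic `≠ p`; Serre, *Local Fields*, VI §2 Thm 1' with Cor. 1') is the remaining
representation-theoretic input of the corrected Artin–Katz integrality statement
`Literature.NumberTheory.GaloisRepresentations.GaloisRep.exists_natCast_eq_artinConductorAt_of_hasOpenInertiaKerAt` (see the DAG in the
tenure notes and `ArtinConductorIntegralityProofs`).  This file vendors the objects and the two
arithmetic inputs of Serre's proof of Thm 1' (VI §2, pp. 99–103) so that the proof itself — the
Brauer-induction bookkeeping, Props. 2, 4, 5 of VI §2 in "numerator form", a Lefschetz-principle
reduction from an arbitrary coefficient field to `ℂ` resp. to a finite field — can be carried out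
sorry-free in `ArtinRepresentationProofs.lean` from named facts only:

* (Serre's function `i_G` is the tree's `Literature.lowerIndex 𝔓 G s : ℕ∞` of `HerbrandTheorem`,
  "`i_G(s) ≥ i + 1 ⇔ s ∈ G_i`", `i_G(1) = ⊤`; below it enters through `(i_G(s)).toNat` at
  `s ≠ 1`, where it is finite;)
* `Literature.artinSum ι φ = Σ_s ι(s) · (φ(1) − φ(s))` — for `ι = i_G` on `G = G_0` this is
  `g_0 · f(φ)`, `f(φ) = (φ, a_G)` Serre's pairing with the Artin character
  `a_G(s) = -i_G(s)` (`s ≠ 1`), `a_G(1) = Σ_{s ≠ 1} i_G(s)` (VI §2; Cor. 1 to Prop. 2: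
  `f(φ) = Σ_i (g_i/g_0)(φ(1) − φ(G_i))`); the numerator form avoids all divisions and is what the
  proofs manipulate (an abstract finite group `Γ` with a weight `ι : Γ → ℕ`);
* `Literature.NumberTheory.GaloisRepresentations.card_inf_inertia_dvd_finsum_lowerIndex` — **integrality of the different exponent**
  (IV §1, Cor. to Prop. 4: `v_{K'}(𝔇_{K'/K}) = (1/e') Σ_{s ∉ H} i_G(s)`, `e' = e_{L/K'}`; so
  `e' = |H ∩ G_0|` divides `Σ_{s ∉ H} i_G(s)`), the input of VI §2 Prop. 4 (induction formula),
  a named fact;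
* `Literature.NumberTheory.GaloisRepresentations.card_inf_inertia_dvd_finsum_card_inf_ramificationSubgroup` — **integrality of `f(χ)` for a
  character `χ` of degree one** (VI §2 Prop. 5 and its Corollary:
  `f(χ) = Σ_{i=0}^{c_χ} g_i/g_0 = φ_{L/K}(c_χ) + 1` "and this is an integer `≥ 0`", by Herbrand's
  theorem and the Hasse–Arf theorem), a named fact;
* `Literature.NumberTheory.GaloisRepresentations.hasseArf` — the **Hasse–Arf theorem** as printed (IV §3: the jumps of the upper numbering
  filtration of an abelian Galois group are integers; proof V §7), the leaf below the previous
  fact, a named fact;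
* `Literature.NumberTheory.GaloisRepresentations.exists_natCast_eq_artinExponent_finiteField` — Artin's theorem over a **finite**
  coefficient field of characteristic `ℓ ≠ p` (Katz, Prop. 1.9 with `A = 𝔽_λ`; Serre, *Linear
  Representations* §19.3 (iii) with Thm 44, `k = ℤ/ℓℤ`), a named fact: the proofs file reduces an
  arbitrary coefficient field of characteristic `ℓ` to this case (and characteristic `0` to `ℂ`,
  where `Literature.RepresentationTheory.FiniteGroups.brauer_induction` applies).

## The source (Serre, *Local Fields*, Ch. IV §1 and Ch. VI §§1–2), as printed

IV §1 (pp. 61–64): Lemma 1 and Prop. 1 (`G_i`, decreasing normal subgroups, `G_0` the inertia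
group, `G_i = 1` for `i ≫ 0`); `i_G(s) = v_L(s(x) − x)`, "`i_G(s) ≥ i + 1 ⇔ s ∈ G_i`,
`i_G(tst⁻¹) = i_G(s)`"; Prop. 2 (`H ⊂ G`: `i_H(s) = i_G(s)`, `H_i = G_i ∩ H`); Prop. 3
(quotients, Herbrand–Tate); Prop. 4 (`v_L(𝔇_{L/K}) = Σ_{s ≠ 1} i_G(s) = Σ_i (|G_i| − 1)`) and its
Corollary (`v_{K'}(𝔇_{K'/K}) = (1/e') Σ_{s ∉ H} i_G(s)`, by transitivity of the different,
III §4 Prop. 8); Remark 2 (globalisation to a Dedekind domain and a prime `𝔓` of a Galois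
extension with separable residue extension: "`s ∈ G_i(𝔓) ⇔ s(x) ≡ x mod 𝔓^{i+1}` for all
`x ∈ B`… similar translations of all the other results of this chapter can be made").
VI §1 (p. 98): Brauer's theorem (every character is a `ℤ`-combination of characters induced from
degree-one characters of subgroups).  VI §2 (pp. 99–103): `a_G`, Thm 1, Thm 1'
(`f(χ) ∈ ℤ_{≥0}`), Prop. 1 (`a_G = (a_{G_0})^*`), Prop. 2 with Cor. 1, Cor. 1'
(`f(χ) = Σ (g_i/g_0) codim V^{G_i}`), Cor. 2; Prop. 3 (quotients); Prop. 4
(`a_G|_H = λ r_H + f_{K'/K} a_H`, `λ = v_K(𝔡_{K'/K})`) with Cor.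
(`f(ψ^*) = v_K(𝔡_{K'/K}) ψ(1) + f_{K'/K} f(ψ)`); Prop. 5 (`χ` of degree `1`:
`f(χ) = φ_{L/K}(c_χ) + 1 = Σ_{i=0}^{c_χ} g_i/g_0`) with Cor. ("this is an integer `≥ 0`":
Herbrand's theorem IV §3 Lemma 5, transitivity of `φ`, Hasse–Arf V §7 "since `G/H` is abelian");
proof of Thms 1 and 1' (Brauer's theorem reduces to `f(χ^*)` for `χ` of degree `1` of a
subgroup, integral by the two corollaries).

## Mathlib search

Mathlib (this pin) has `Ideal.inertia`, the different ideal `differentIdeal` with transitivity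
(`differentIdeal_eq_differentIdeal_mul_differentIdeal`) and the tame criterion
(`dvd_differentIdeal_iff`), but no higher ramification groups, no `i_G`, no Hilbert different
formula `v_𝔓(𝔇) = Σ_i (|G_i| − 1)`, no Hasse–Arf theorem (`lean search 'HasseArf|hasseArf'`:
no Mathlib hits) and no Artin character.  The tree's `Literature` has the lower and upper
ramification filtrations and Herbrand functions (`RamificationFiltration`, with `herbrand_quotient`
a named fact), Serre's `i_G` (`Literature.NumberTheory.GaloisRepresentations.lowerIndex`, `HerbrandTheorem`, reused here),
`Literature.NumberTheory.GaloisRepresentations.artinExponent` (`ArtinConductorIntegrality`), Brauer's induction theorem as the named fact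
`Literature.RepresentationTheory.FiniteGroups.brauer_induction` with `indClassFun` (reused here, not restated), and
`Ideal.isPGroup_ramificationSubgroup_one` (`TameInertiaProofs`).  Nothing here duplicates an
existing declaration.

## References

* J.-P. Serre, *Local Fields*, GTM 67 (1979), Ch. III §4 Prop. 8; Ch. IV §1 (Props. 1–4,
  Cor. to Prop. 4, Remark 2), §3 (Props. 12–15, Lemma 5, Theorem of Hasse–Arf); Ch. V §7;
  Ch. VI §1 (Brauer's theorem), §2 (Props. 1–5 and corollaries, Thms 1, 1'), §3.
  [SerreLocalFields1979]
* J.-P. Serre, *Linear Representations of Finite Groups*, GTM 42 (1977), §7.2, §10.5 Thm 20,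
  §19.1, §19.2 Thm 44, §19.3. [SerreLinearRepresentations1977]
* N. M. Katz, *Gauss Sums, Kloosterman Sums, and Monodromy Groups* (1988), Ch. 1, Prop. 1.9.
  [Katz1988]
* J. Neukirch, *Algebraic Number Theory* (1999), Ch. II §10, Ch. VII §11. [NeukirchANT1999]
-/

noncomputable section

open scoped NumberField
open IsDedekindDomain Module

universe u v w

namespace Literature.NumberTheory.GaloisRepresentations

/-! ### The numerator form of Serre's `f(φ) = (φ, a_G)` -/

section ArtinSum

variable {Γ : Type*} [Group Γ] [Fintype Γ] {A : Type*} [CommRing A]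

/-- **Numerator form of Serre's pairing with the Artin character.**  For a finite group `Γ`
(in applications: the inertia group `G_0`, or a subgroup `H` of it with the induced filtration
`H_i = G_i ∩ H`, IV §1 Prop. 2), a weight `ι : Γ → ℕ` (in applications `ι = i_Γ`, Serre's
`i_G` = `Literature.NumberTheory.GaloisRepresentations.lowerIndex` pulled back to `Γ`, finite off `1`) and a function `φ : Γ → A`:
`artinSum ι φ = Σ_{s ∈ Γ} ι(s) (φ(1) − φ(s))`.  The term `s = 1` vanishes whatever `ι(1)` is.
For `Γ = G_0` (totally ramified case, residue degree `1`) and `ι = i_G` this is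
`Σ_{s ≠ 1} i_G(s)(φ(1) − φ(s)) = Σ_{s} a_G(s) φ(s) = g_0 · f(φ)`, `f(φ) = (φ, a_G)`, since
`a_G(s) = -i_G(s)` for `s ≠ 1` and `a_G(1) = Σ_{s ≠ 1} i_G(s)` (`a_G` is real and
`a_G(s⁻¹) = a_G(s)`); by Cor. 1 to Prop. 2, `g_0 f(φ) = Σ_i (g_i φ(1) − Σ_{s ∈ G_i} φ(s))`.
Ref: Serre, *Local Fields*, Ch. VI §2, definition of `a_G` and `f(φ) = (φ, a_G)`, Prop. 2 and
Cor. 1 (pp. 99–100). [cite: SerreLocalFields1979, Ch. VI §2, Prop. 2 and Cor. 1] -/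
def artinSum (ι : Γ → ℕ) (φ : Γ → A) : A :=
  ∑ s, (ι s : A) * (φ 1 - φ s)

/-- Unfolding lemma for `artinSum`. [folklore] -/
theorem artinSum_def (ι : Γ → ℕ) (φ : Γ → A) :
    artinSum ι φ = ∑ s, (ι s : A) * (φ 1 - φ s) :=
  rfl

/-- `artinSum ι` is additive in `φ` (`f` is `ℤ`-linear on class functions, VI §2).
[cite: SerreLocalFields1979, Ch. VI §2, f(φ) = (φ, a_G)] -/
theorem artinSum_add (ι : Γ → ℕ) (φ ψ : Γ → A) :
    artinSum ι (φ + ψ) = artinSum ι φ + artinSum ι ψ := by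
  simp only [artinSum_def, Pi.add_apply, ← Finset.sum_add_distrib]
  exact Finset.sum_congr rfl fun s _ => by ring

/-- `artinSum ι` commutes with scalars (`f` is linear on class functions, VI §2).
[cite: SerreLocalFields1979, Ch. VI §2, f(φ) = (φ, a_G)] -/
theorem artinSum_smul (ι : Γ → ℕ) (c : A) (φ : Γ → A) :
    artinSum ι (c • φ) = c * artinSum ι φ := by
  simp only [artinSum_def, Pi.smul_apply, smul_eq_mul, Finset.mul_sum]
  exact Finset.sum_congr rfl fun s _ => by ring

end ArtinSum

/-! ### The arithmetic inputs (named facts, finite level, Dedekind globalisation) -/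

section ArithmeticInputs

variable (R : Type*) {K L : Type*} [CommRing R] [Field K] [Field L] [Algebra R K] [Algebra R L]
  [Algebra K L] [IsScalarTower R K L]

/-- **Integrality of the exponent of the different of a subextension** (Serre, IV §1, Corollary
to Prop. 4).  Let `R` be a Dedekind domain with fraction field `K`, `L/K` finite Galois with group
`G`, `𝔓` a maximal ideal of `S_L = integralClosure R L` with separable residue extension, `G_i`
the ramification groups of `𝔓` and `i_G` Serre's function (`Literature.NumberTheory.GaloisRepresentations.lowerIndex`).  For a
subgroup `H ≤ G` with fixed field `K' = L^H` and `𝔓' = 𝔓 ∩ K'`, Serre's Corollary reads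
`v_{𝔓'}(𝔇_{K'/K}) = (1/e') Σ_{s ∉ H} i_G(s)` with `e' = e_{L/K'}(𝔓) = |H ∩ G_0|` (from Prop. 4,
`v_𝔓(𝔇_{L/K}) = Σ_{s ≠ 1} i_G(s)`, the same for `L/K'` by Prop. 2, and transitivity of the
different, III §4 Prop. 8; globalised as in IV §1 Remark 2, the different being compatible with
completion, III §4).  Vendored is the consequence used in Artin's proof (VI §2 Prop. 4 and its
Cor.): **`|H ∩ G_0|` divides `Σ_{s ∉ H} i_G(s)`**, the quotient being the natural number
`v_{𝔓'}(𝔇_{K'/K})`.  Here `i_G = Literature.lowerIndex 𝔓 G : G → ℕ∞` (`HerbrandTheorem`), finite at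
`s ≠ 1` (so `.toNat` loses nothing for `s ∉ H`) and `0` off `G_0`, so only `s ∈ G_0 ∖ H`
contribute; a `finsum`, equal to the finite sum since `G` is finite.  Statement only.
Ref: Serre, *Local Fields*, Ch. IV §1, Prop. 4 and Corollary (p. 64), Remark 2; Ch. III §4
Prop. 8. [cite: SerreLocalFields1979, Ch. IV §1, Cor. to Prop. 4]
[cite: SerreLocalFields1979, Ch. III §4 Prop. 8] -/
def card_inf_inertia_dvd_finsum_lowerIndex : Prop :=
  ∀ [IsDedekindDomain R] [IsFractionRing R K] [FiniteDimensional K L] [IsGalois K L]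
    (𝔓 : Ideal (integralClosure R L)) [𝔓.IsMaximal]
    [Algebra.IsSeparable (R ⧸ 𝔓.under R) (integralClosure R L ⧸ 𝔓)] (H : Subgroup (L ≃ₐ[K] L)),
    Nat.card ↥(H ⊓ 𝔓.inertia (L ≃ₐ[K] L)) ∣
      ∑ᶠ (s : L ≃ₐ[K] L) (_ : s ∉ H), (lowerIndex 𝔓 (L ≃ₐ[K] L) s).toNat

open scoped Classical in
/-- **Integrality of `f(χ)` for a character of degree one** (Serre, VI §2, Prop. 5 and its
Corollary).  Same setting; let `H ≤ G = Gal(L/K)` be a subgroup (`K' = L^H`, so `Gal(L/K') = H`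
with ramification groups `H_i = G_i ∩ H` at `𝔓`, IV §1 Prop. 2, and inertia group
`H_0 = H ∩ G_0`) and `θ : H → ℂˣ` a character of degree one.  By Prop. 5 (from Cor. 1 to
Prop. 2), `f(θ) = Σ_{i=0}^{c_θ} h_i/h_0`, where `c_θ` is the largest `i` with `θ|_{H_i} ≠ 1`,
i.e. `h_0 f(θ) = Σ_{i : H_i ⊄ ker θ} |H_i|` (the set of such `i` is the initial segment
`[0, c_θ]` as the `H_i` decrease); by the Corollary ("`f(χ) = φ_{K'/K}(c'_χ) + 1`, and this is an
integer `≥ 0`": Herbrand's theorem IV §3 Lemma 5, transitivity of `φ` IV §3 Prop. 15, and the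
Hasse–Arf theorem V §7 for the abelian group `H/ker θ`), **`|H ∩ G_0|` divides
`Σ_{i : H ∩ G_i ⊄ ker θ} |H ∩ G_i|`**.  (Applied at the prime `𝔓` of the global extension via
VI §3, `f(θ, 𝔭') = f(θ|_{D})`; a `finsum` over `i : ℕ`, finite since `G_i = 1` for `i ≫ 0`.)
The leaf below it is `hasseArf` together with `herbrand_quotient`.  Statement only.
Ref: Serre, *Local Fields*, Ch. VI §2, Prop. 5 and Corollary (p. 102); Ch. IV §3 Lemma 5,
Prop. 15, Theorem (Hasse–Arf). [cite: SerreLocalFields1979, Ch. VI §2, Prop. 5 and its Corollary]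
[cite: SerreLocalFields1979, Ch. IV §3, Theorem (Hasse–Arf)] -/
def card_inf_inertia_dvd_finsum_card_inf_ramificationSubgroup : Prop :=
  ∀ [IsDedekindDomain R] [IsFractionRing R K] [FiniteDimensional K L] [IsGalois K L]
    (𝔓 : Ideal (integralClosure R L)) [𝔓.IsMaximal]
    [Algebra.IsSeparable (R ⧸ 𝔓.under R) (integralClosure R L ⧸ 𝔓)] (H : Subgroup (L ≃ₐ[K] L))
    (θ : H →* ℂˣ),
    Nat.card ↥(H ⊓ 𝔓.inertia (L ≃ₐ[K] L)) ∣
      ∑ᶠ i : ℕ, if (H ⊓ 𝔓.ramificationSubgroup (L ≃ₐ[K] L) i).subgroupOf H ≤ θ.ker then 0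
        else Nat.card ↥(H ⊓ 𝔓.ramificationSubgroup (L ≃ₐ[K] L) i)

/-- **The Hasse–Arf theorem** (finite level, as printed by Serre).  Same setting, with
`G = Gal(L/K)` abelian: if `v` is a jump of the upper-numbering filtration `G^v`
(`Literature.upperRamificationSubgroup 𝔓 G`, i.e. `G^w ≠ G^v` for all `w > v`), then `v` is an
integer (necessarily `≥ 0` here: `G^v = G_0` for `v ≤ 0`).  Equivalently (IV §3): if
`G_i ≠ G_{i+1}` then `φ_{L/K}(i)` is an integer.  Proof: V §7 (or via local class field theory,
XV §2).  Statement only; the input of `card_inf_inertia_dvd_finsum_card_inf_ramificationSubgroup`.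
Ref: Serre, *Local Fields*, Ch. IV §3, Theorem (Hasse–Arf) (p. 76); Ch. V §7.
[cite: SerreLocalFields1979, Ch. IV §3, Theorem (Hasse–Arf)] -/
def hasseArf : Prop :=
  ∀ [IsDedekindDomain R] [IsFractionRing R K] [FiniteDimensional K L] [IsGalois K L]
    (𝔓 : Ideal (integralClosure R L)) [𝔓.IsMaximal]
    [Algebra.IsSeparable (R ⧸ 𝔓.under R) (integralClosure R L ⧸ 𝔓)]
    (_hab : ∀ a b : L ≃ₐ[K] L, a * b = b * a) (v : ℝ)
    (_hjump : ∀ w : ℝ, v < w →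
      upperRamificationSubgroup 𝔓 (L ≃ₐ[K] L) w ≠ upperRamificationSubgroup 𝔓 (L ≃ₐ[K] L) v),
    ∃ n : ℕ, (n : ℝ) = v

end ArithmeticInputs

/-! ### Artin's theorem over a finite coefficient field (Katz 1.9, Serre *LinRep* §19.3) -/

section FiniteField

variable {K : Type u} [Field K] {A : Type v} [Field A] {M : Type w} [AddCommGroup M] [Module A M]

/-- **Artin's theorem for the inertia group over a finite coefficient field** — the case
`A = 𝔽_λ`, `char 𝔽_λ = ℓ ≠ p`, of `Literature.NumberTheory.GaloisRepresentations.exists_natCast_eq_artinExponent` (same binders plus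
`[Finite A]`).  For `K` a number field, `E/K` finite normal in `K̄`, `𝔓 ∣ v`, `𝔓_E = 𝔓 ∩ E`,
`G_0 = I(𝔓_E)`, and a representation `τ` of `G_0` on a finite-dimensional `A`-vector space with
`A` finite and `(q_v : A) ≠ 0`: `f(τ) = Σ_{i ≥ 0} (g_i/g_0) codim M^{G_i} ∈ ℕ`.  Printed as: Katz,
Prop. 1.9 — "`A` an arbitrary complete noetherian local ring with finite residue field `𝔽_λ` of
characteristic `ℓ ≠ p`, `M` a free `A`-module of finite rank on which `I` acts continuously ⇒
`Swan(M) ∈ ℤ_{≥0}`" (a finite field is such a ring; a finite group acting on a finite set acts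
continuously; `f(τ) = codim M^{G_0} + Swan`), whose proof for `A = 𝔽_λ` is Serre, *Linear
Representations*, §19.3: for `k = ℤ/ℓℤ` and a `k[G]`-module `M` (`G = G_0`, `F/E` totally
ramified), `b(M) = dim Hom^G(Sw_G ⊗ k, M) ∈ ℕ` (Thm 44: `Sw_G` is a projective `ℤ_ℓ[G]`-module)
and (iii) `b(M) = Σ_{i ≥ 1} (g_i/g) dim_k (M/M^{G_i})`.  The general coefficient field of
characteristic `ℓ` is reduced to this case in `ArtinRepresentationProofs` (a representation of a
finite group is defined over a finitely generated subring, which maps to a finite field; `codim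
M^{G_i}`, `i ≥ 1`, is read off from traces since `G_1` is a `p`-group).  Statement only.
[cite: Katz1988, Ch. 1, Prop. 1.9 (and its proof)]
[cite: SerreLinearRepresentations1977, §19.3 (iii) and Thm 44] -/
def exists_natCast_eq_artinExponent_finiteField : Prop :=
  ∀ [NumberField K] [Finite A] [FiniteDimensional A M] {v : HeightOneSpectrum (𝓞 K)}
    {𝔓 : Ideal (absIntegers (𝓞 K) K)} (_h𝔓 : 𝔓 ∈ v.primesAbove)
    (E : IntermediateField K (AlgebraicClosure K)) [FiniteDimensional K E] [Normal K E]
    (τ : Representation A ((𝔓.comap (E.integralClosureToAbsIntegers (𝓞 K))).inertia (E ≃ₐ[K] E)) M)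
    (_hchar : (v.residueCard : A) ≠ 0),
    ∃ n : ℕ, (n : ℝ) =
      artinExponent (𝔓.comap (E.integralClosureToAbsIntegers (𝓞 K))) (E ≃ₐ[K] E)
        ((𝔓.comap (E.integralClosureToAbsIntegers (𝓞 K))).inertia (E ≃ₐ[K] E)).subtype τ

/-- The finite-field case is a special case of `exists_natCast_eq_artinExponent` (sanity check of
the binders). [cite: Katz1988, Ch. 1, Prop. 1.9 (and its proof)] -/
theorem exists_natCast_eq_artinExponent_finiteField_of
    (h : exists_natCast_eq_artinExponent (K := K) (A := A) (M := M)) :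
    exists_natCast_eq_artinExponent_finiteField (K := K) (A := A) (M := M) := by
  intro _ _ _ v 𝔓 h𝔓 E _ _ τ hchar
  exact h h𝔓 E τ hchar

end FiniteField

end Literature.NumberTheory.GaloisRepresentations

end
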